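import Mathlib
import Summits.ValiantsHypothesis.ValiantsHypothesis.Theorems.LacunarySymmetroidMatrixDescartesCensusBoxKit

/-!
# Wall bubbling for `DoorA26` — obligation (M): the SIGNED-SUPPORT REALISABILITY (SSR) lemmas of the second-order sieve, kernel form

LINE / STUB.  Crux `Theses.LacunarySymmetroid.DoorA26` (stmt-ValiantsHypothesis-19979; OPEN, typed, never asserted), line
`Cruxes/DoorA26/Lines/wall_bubbling.lean`, obligation **(M) `Stmt.stub_mixedWalls`**.  The line's (M)-INSTRUMENT (val-idea-15 g2,
`Lines/wall_bubbling_M-sieve.md`: exact per-wall-point tropical sieve, 85 / 98 zero-survivor runs) lists in its SOUNDNESS LEDGER (§2.6 (iv)) the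
«SSR lemmas» §2.5 — elementary linear algebra of letters in `(Sym₂ℝ, det) ≅ ℝ^{1,2}` that decides which zero/sign patterns a realisable Gram matrix
can have; by the memo's own tally they carry most of the interval kills (L-i 3688, L-vi 591, L-ix 369, L-x 126 …).  (L-i) is already kernel
(`…WallBubblingPureDSieve.exists_smul_of_polar_eq_zero`: two `det`-null letters with vanishing polar form are parallel).  This file puts the
remaining letter-level lemmas into the kernel, in the census kit's scalar currency `S = [[a,b],[b,c]]`, `det S = ac − b²`,
`polarDet(S,S') = ac' + ca' − 2bb' = 2·polar(S,S')` (so «orthogonal» = `polarDet = 0`):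
* (L-vi) `ssr_det_nonpos_of_orth_null` / `ssr_det_neg_of_orth_null` — a letter `det`-orthogonal to a NONZERO NULL letter is indefinite or null
  (`det ≤ 0`; `< 0` if non-null): the `J`-orthogonal complement of a null vector is majority-semidefinite;
* (L-iii) `ssr_det_nonpos_of_orth_definite` / `ssr_eq_zero_of_orth_definite_null` — a letter orthogonal to a DEFINITE letter is indefinite, and
  if null it is zero: nothing null or lone-signed is orthogonal to a lone-signed vector;
* (L-vii) `ssr_polarDet_sq_of_common_null` / `ssr_polarDet_ne_zero_of_common_null` — two letters orthogonal to the same nonzero null letter have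
  `polarDet(T,U)² = 4·det T·det U`; hence two NON-null such letters are NOT orthogonal to each other;
* (L-v) `ssr_frame_signs` — three pairwise orthogonal non-null letters have exactly ONE definite member (signs `{ℓ, −ℓ, −ℓ}`), from (L-iii) and
  the Gram determinant `G3 ≥ 0` of the census kit (`Census.g3_nonneg`);
* (L-x) `ssr_polarDet_nonneg_of_psd` / `ssr_polarDet_pos_of_pd_psd` — cone orientation: two positive-SEMIdefinite letters have `polarDet ≥ 0`,
  `> 0` as soon as one is definite and the other nonzero (so for semidefinite letters `sgn polar = τ_S τ_T`, `τ` = the orientation).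
Pure real algebra (`nlinarith`); no new definitions; a rung of (M) (soundness-ledger item (iv) of the instrument), nothing about (M) itself.

HONEST FRAMING.  Cell `pub-symmetroid`, seat val-sym-door-p2 g11 (re-pointed W1, R2664), `--supports stmt-ValiantsHypothesis-19979 --as helper`.
(M), (W), (R) and `DoorA26` stay OPEN; registers unchanged; nothing on `MatrixDescartes` (stmt-ValiantsHypothesis-18050) or `VP ≠ VNP`.
[folklore: geometry of the light cone of `ℝ^{1,2}`; cf. Cecil, Lie Sphere Geometry, §1 for the complement facts]
-/

-- `Summit.ValiantsHypothesis.ValiantsHypothesis.…` repeats a component by the D-0017 layout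
-- (single-conjunct summit), which the `dupNamespace` linter flags; the name is mandated.
set_option linter.dupNamespace false

namespace Summit.ValiantsHypothesis.ValiantsHypothesis.Theorems.LacunarySymmetroidMatrixDescartes.WallBubbling

open Summit.ValiantsHypothesis.ValiantsHypothesis.Theorems.LacunarySymmetroidMatrixDescartes.Census (g3_nonneg)

/-! ## (L-vi) the orthogonal complement of a nonzero null letter -/

/-- **(L-vi)** If `S = [[a,b],[b,c]]` is NULL (`ac = b²`) and nonzero, and `T = [[a',b'],[b',c']]` is `det`-orthogonal to it
(`ac' + ca' − 2bb' = 0`), then `det T ≤ 0`. [folklore] -/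
theorem ssr_det_nonpos_of_orth_null (a b c a' b' c' : ℝ) (hS : a * c - b ^ 2 = 0) (hS0 : a ≠ 0 ∨ b ≠ 0 ∨ c ≠ 0)
    (horth : a * c' + c * a' - 2 * (b * b') = 0) : a' * c' - b' ^ 2 ≤ 0 := by
  by_cases ha : a = 0
  · -- then b = 0 and c ≠ 0, so a' = 0
    have hb : b = 0 := by subst ha; nlinarith
    have hc : c ≠ 0 := by
      rcases hS0 with h | h | h
      · exact absurd ha h
      · exact absurd hb h
      · exact h
    have ha' : a' = 0 := by
      subst ha; subst hb
      have : c * a' = 0 := by linarith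
      rcases mul_eq_zero.mp this with h | h
      · exact absurd h hc
      · exact h
    subst ha'; nlinarith [sq_nonneg b']
  · -- the vector `v = (b, −a)` is isotropic for `T`: `a·(a'b² − 2b'ab + c'a²) = a²·(ac' + ca' − 2bb')` using `ac = b²`
    have hiso : a' * b ^ 2 - 2 * b' * a * b + c' * a ^ 2 = 0 := by
      have h1 : a * (a' * b ^ 2 - 2 * b' * a * b + c' * a ^ 2) = a ^ 2 * (a * c' + c * a' - 2 * (b * b')) := by
        have : b ^ 2 = a * c := by linarith
        rw [this]; ring
      rw [horth, mul_zero] at h1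
      rcases mul_eq_zero.mp h1 with h | h
      · exact absurd h ha
      · exact h
    -- a form with a nonzero isotropic vector has `det ≤ 0`: `(a'c' − b'²)·a² = −(a'b − b'a)²` after using the isotropy relation
    have key : (a' * c' - b' ^ 2) * a ^ 2 = -(a' * b - b' * a) ^ 2 := by linear_combination a' * hiso
    have ha2 : 0 < a ^ 2 := by positivity
    by_contra hcon
    have hpos : 0 < a' * c' - b' ^ 2 := not_le.mp hcon
    have : 0 < (a' * c' - b' ^ 2) * a ^ 2 := mul_pos hpos ha2
    nlinarith [sq_nonneg (a' * b - b' * a)]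

/-- **(L-vi), strict form**: a NON-NULL letter orthogonal to a nonzero null letter is INDEFINITE (`det < 0`). [folklore] -/
theorem ssr_det_neg_of_orth_null (a b c a' b' c' : ℝ) (hS : a * c - b ^ 2 = 0) (hS0 : a ≠ 0 ∨ b ≠ 0 ∨ c ≠ 0)
    (horth : a * c' + c * a' - 2 * (b * b') = 0) (hT : a' * c' - b' ^ 2 ≠ 0) : a' * c' - b' ^ 2 < 0 :=
  lt_of_le_of_ne (ssr_det_nonpos_of_orth_null a b c a' b' c' hS hS0 horth) hT

/-! ## (L-iii) the orthogonal complement of a definite letter -/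

/-- **(L-iii)** If `S` is DEFINITE (`ac − b² > 0`) and `T` is `det`-orthogonal to `S`, then `det T ≤ 0`; the key identity is
`a·(a'c' − b'²) = −(c·a'² − 2b·a'b' + a·b'²)` given `ac' = 2bb' − ca'`, with the right-hand form definite of the sign of `a`. [folklore] -/
theorem ssr_det_nonpos_of_orth_definite (a b c a' b' c' : ℝ) (hS : 0 < a * c - b ^ 2)
    (horth : a * c' + c * a' - 2 * (b * b') = 0) : a' * c' - b' ^ 2 ≤ 0 := by
  have ha : a ≠ 0 := by rintro rfl; nlinarith [sq_nonneg b]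
  have key : a ^ 2 * (a' * c' - b' ^ 2) = -((a * b' - b * a') ^ 2 + (a * c - b ^ 2) * a' ^ 2) := by
    linear_combination (a * a') * horth
  have ha2 : 0 < a ^ 2 := by positivity
  have hnn : 0 ≤ (a * b' - b * a') ^ 2 + (a * c - b ^ 2) * a' ^ 2 := by positivity
  by_contra hcon
  have : 0 < a ^ 2 * (a' * c' - b' ^ 2) := mul_pos ha2 (not_le.mp hcon)
  linarith

/-- **(L-iii), null case**: a NULL letter orthogonal to a definite letter is ZERO. [folklore] -/
theorem ssr_eq_zero_of_orth_definite_null (a b c a' b' c' : ℝ) (hS : 0 < a * c - b ^ 2)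
    (horth : a * c' + c * a' - 2 * (b * b') = 0) (hT : a' * c' - b' ^ 2 = 0) : a' = 0 ∧ b' = 0 ∧ c' = 0 := by
  have ha : a ≠ 0 := by rintro rfl; nlinarith [sq_nonneg b]
  have key : a ^ 2 * (a' * c' - b' ^ 2) = -((a * b' - b * a') ^ 2 + (a * c - b ^ 2) * a' ^ 2) := by
    linear_combination (a * a') * horth
  rw [hT, mul_zero] at key
  have h1 : (a * b' - b * a') ^ 2 = 0 := by nlinarith [sq_nonneg (a * b' - b * a'), mul_nonneg hS.le (sq_nonneg a')]
  have h2 : (a * c - b ^ 2) * a' ^ 2 = 0 := by nlinarith [sq_nonneg (a * b' - b * a'), mul_nonneg hS.le (sq_nonneg a')]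
  have ha' : a' = 0 := by
    rcases mul_eq_zero.mp h2 with h | h
    · exact absurd h hS.ne'
    · exact pow_eq_zero_iff (two_ne_zero) |>.mp h
  have hb' : b' = 0 := by
    have : a * b' - b * a' = 0 := pow_eq_zero_iff (two_ne_zero) |>.mp h1
    rw [ha', mul_zero, sub_zero] at this
    rcases mul_eq_zero.mp this with h | h
    · exact absurd h ha
    · exact h
  refine ⟨ha', hb', ?_⟩
  subst ha'; subst hb'
  have : a * c' = 0 := by linarith
  rcases mul_eq_zero.mp this with h | h
  · exact absurd h ha
  · exact h

/-! ## (L-vii) two letters orthogonal to the same null letter -/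

/-- **(L-vii), identity**: if `T` and `U` are both `det`-orthogonal to a NONZERO NULL letter `S`, then `polarDet(T,U)² = 4·det T·det U`
(both lie in the degenerate plane `S^⊥ = span(S, X)`). [folklore] -/
theorem ssr_polarDet_sq_of_common_null (a b c a' b' c' a'' b'' c'' : ℝ) (hS : a * c - b ^ 2 = 0) (hS0 : a ≠ 0 ∨ b ≠ 0 ∨ c ≠ 0)
    (hT : a * c' + c * a' - 2 * (b * b') = 0) (hU : a * c'' + c * a'' - 2 * (b * b'') = 0) :
    (a' * c'' + c' * a'' - 2 * (b' * b'')) ^ 2 = 4 * (a' * c' - b' ^ 2) * (a'' * c'' - b'' ^ 2) := by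
  by_cases ha : a = 0
  · have hb : b = 0 := by subst ha; nlinarith
    have hc : c ≠ 0 := by
      rcases hS0 with h | h | h
      · exact absurd ha h
      · exact absurd hb h
      · exact h
    subst ha; subst hb
    have ha' : a' = 0 := by
      have : c * a' = 0 := by linarith
      rcases mul_eq_zero.mp this with h | h
      · exact absurd h hc
      · exact h
    have ha'' : a'' = 0 := by
      have : c * a'' = 0 := by linarith
      rcases mul_eq_zero.mp this with h | h
      · exact absurd h hc
      · exact h
    subst ha'; subst ha''; ring
  · -- isotropy of `v = (b, −a)` for `T` and `U` (as in (L-vi)), then eliminate `c'·a²` and `c''·a²`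
    have hbb : b ^ 2 = a * c := by linarith
    have hisoT : a' * b ^ 2 - 2 * b' * a * b + c' * a ^ 2 = 0 := by
      have h1 : a * (a' * b ^ 2 - 2 * b' * a * b + c' * a ^ 2) = a ^ 2 * (a * c' + c * a' - 2 * (b * b')) := by
        rw [hbb]; ring
      rw [hT, mul_zero] at h1
      rcases mul_eq_zero.mp h1 with h | h
      · exact absurd h ha
      · exact h
    have hisoU : a'' * b ^ 2 - 2 * b'' * a * b + c'' * a ^ 2 = 0 := by
      have h1 : a * (a'' * b ^ 2 - 2 * b'' * a * b + c'' * a ^ 2) = a ^ 2 * (a * c'' + c * a'' - 2 * (b * b'')) := by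
        rw [hbb]; ring
      rw [hU, mul_zero] at h1
      rcases mul_eq_zero.mp h1 with h | h
      · exact absurd h ha
      · exact h
    -- multiply the claim by `a⁴ ≠ 0` and substitute `c'a² = 2b'ab − a'b²`, `c''a² = 2b''ab − a''b²`
    have ha4 : a ^ 4 ≠ 0 := pow_ne_zero 4 ha
    apply mul_left_cancel₀ ha4
    have hc' : c' * a ^ 2 = 2 * b' * a * b - a' * b ^ 2 := by linarith
    have hc'' : c'' * a ^ 2 = 2 * b'' * a * b - a'' * b ^ 2 := by linarith
    have lhs : a ^ 4 * (a' * c'' + c' * a'' - 2 * (b' * b'')) ^ 2 =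
        (a' * (c'' * a ^ 2) + (c' * a ^ 2) * a'' - 2 * (b' * b'') * a ^ 2) ^ 2 := by ring
    have rhs : a ^ 4 * (4 * (a' * c' - b' ^ 2) * (a'' * c'' - b'' ^ 2)) =
        4 * (a' * (c' * a ^ 2) - b' ^ 2 * a ^ 2) * (a'' * (c'' * a ^ 2) - b'' ^ 2 * a ^ 2) := by ring
    rw [lhs, rhs, hc', hc'']
    ring

/-- **(L-vii)**: two NON-NULL letters (here: indefinite, as (L-vi) forces) orthogonal to the same nonzero null letter are NOT orthogonal to each
other. [folklore] -/
theorem ssr_polarDet_ne_zero_of_common_null (a b c a' b' c' a'' b'' c'' : ℝ) (hS : a * c - b ^ 2 = 0) (hS0 : a ≠ 0 ∨ b ≠ 0 ∨ c ≠ 0)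
    (hT : a * c' + c * a' - 2 * (b * b') = 0) (hU : a * c'' + c * a'' - 2 * (b * b'') = 0)
    (hdT : a' * c' - b' ^ 2 ≠ 0) (hdU : a'' * c'' - b'' ^ 2 ≠ 0) : a' * c'' + c' * a'' - 2 * (b' * b'') ≠ 0 := by
  intro h0
  have hsq := ssr_polarDet_sq_of_common_null a b c a' b' c' a'' b'' c'' hS hS0 hT hU
  rw [h0] at hsq
  have hT' := ssr_det_neg_of_orth_null a b c a' b' c' hS hS0 hT hdT
  have hU' := ssr_det_neg_of_orth_null a b c a'' b'' c'' hS hS0 hU hdU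
  have : 0 < 4 * (a' * c' - b' ^ 2) * (a'' * c'' - b'' ^ 2) := by
    have := mul_pos_of_neg_of_neg hT' hU'
    linarith
  rw [← hsq] at this
  simp at this

/-! ## (L-v) orthogonal frames -/

/-- **(L-v)**: three pairwise `det`-orthogonal NON-NULL letters consist of exactly ONE definite and two indefinite letters
(a `J`-orthogonal frame of `ℝ^{1,2}` has signs `{+, −, −}`).  From (L-iii) (no two orthogonal definite letters) and the census kit's Gram
determinant `G3 ≥ 0` (`Census.g3_nonneg`: with vanishing polar forms it reads `4·det S·det T·det U ≥ 0`). [folklore] -/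
theorem ssr_frame_signs (a b c a' b' c' a'' b'' c'' : ℝ)
    (h12 : a * c' + c * a' - 2 * (b * b') = 0) (h23 : a' * c'' + c' * a'' - 2 * (b' * b'') = 0)
    (h13 : a * c'' + c * a'' - 2 * (b * b'') = 0)
    (hd1 : a * c - b ^ 2 ≠ 0) (hd2 : a' * c' - b' ^ 2 ≠ 0) (hd3 : a'' * c'' - b'' ^ 2 ≠ 0) :
    (0 < a * c - b ^ 2 ∧ a' * c' - b' ^ 2 < 0 ∧ a'' * c'' - b'' ^ 2 < 0) ∨
    (a * c - b ^ 2 < 0 ∧ 0 < a' * c' - b' ^ 2 ∧ a'' * c'' - b'' ^ 2 < 0) ∨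
    (a * c - b ^ 2 < 0 ∧ a' * c' - b' ^ 2 < 0 ∧ 0 < a'' * c'' - b'' ^ 2) := by
  have hg := g3_nonneg a b c a' b' c' a'' b'' c''
  rw [h12, h23, h13] at hg
  simp only [mul_zero, sub_zero, add_zero, zero_pow (two_ne_zero)] at hg
  -- hg : 0 ≤ 4 * d1 * d2 * d3
  have hprod : 0 < (a * c - b ^ 2) * (a' * c' - b' ^ 2) * (a'' * c'' - b'' ^ 2) := by
    rcases lt_or_eq_of_le hg with h | h
    · linarith
    · exfalso
      have : 4 * (a * c - b ^ 2) * (a' * c' - b' ^ 2) * (a'' * c'' - b'' ^ 2) ≠ 0 :=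
        mul_ne_zero (mul_ne_zero (mul_ne_zero four_ne_zero hd1) hd2) hd3
      exact this h.symm
  -- at most one definite letter, by (L-iii)
  have n12 : ¬ (0 < a * c - b ^ 2 ∧ 0 < a' * c' - b' ^ 2) := fun ⟨h1, h2⟩ =>
    absurd (ssr_det_nonpos_of_orth_definite a b c a' b' c' h1 h12) (not_le.mpr h2)
  have n13 : ¬ (0 < a * c - b ^ 2 ∧ 0 < a'' * c'' - b'' ^ 2) := fun ⟨h1, h3⟩ =>
    absurd (ssr_det_nonpos_of_orth_definite a b c a'' b'' c'' h1 h13) (not_le.mpr h3)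
  have n23 : ¬ (0 < a' * c' - b' ^ 2 ∧ 0 < a'' * c'' - b'' ^ 2) := fun ⟨h2, h3⟩ =>
    absurd (ssr_det_nonpos_of_orth_definite a' b' c' a'' b'' c'' h2 h23) (not_le.mpr h3)
  rcases lt_or_gt_of_ne hd1 with h1 | h1 <;> rcases lt_or_gt_of_ne hd2 with h2 | h2 <;> rcases lt_or_gt_of_ne hd3 with h3 | h3
  · exfalso
    have : (a * c - b ^ 2) * (a' * c' - b' ^ 2) * (a'' * c'' - b'' ^ 2) < 0 :=
      mul_neg_of_pos_of_neg (mul_pos_of_neg_of_neg h1 h2) h3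
    linarith
  · exact Or.inr (Or.inr ⟨h1, h2, h3⟩)
  · exact Or.inr (Or.inl ⟨h1, h2, h3⟩)
  · exact absurd ⟨h2, h3⟩ n23
  · exact Or.inl ⟨h1, h2, h3⟩
  · exact absurd ⟨h1, h3⟩ n13
  · exact absurd ⟨h1, h2⟩ n12
  · exact absurd ⟨h1, h2⟩ n12

/-! ## (L-x) cone orientation for semidefinite letters -/

/-- **(L-x)**: two positive-SEMIDEFINITE letters (`a, c ≥ 0`, `ac ≥ b²`, same for `T`) have non-negative polar form
`ac' + ca' − 2bb' ≥ 0` (AM–GM twice). [folklore] -/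
theorem ssr_polarDet_nonneg_of_psd (a b c a' b' c' : ℝ) (ha : 0 ≤ a) (hc : 0 ≤ c) (hS : b ^ 2 ≤ a * c)
    (ha' : 0 ≤ a') (hc' : 0 ≤ c') (hT : b' ^ 2 ≤ a' * c') : 0 ≤ a * c' + c * a' - 2 * (b * b') := by
  -- (ac' + ca')² ≥ 4·ac·a'c' ≥ 4 b² b'², and ac' + ca' ≥ 0
  have hsum : 0 ≤ a * c' + c * a' := by positivity
  have hsq : (2 * (b * b')) ^ 2 ≤ (a * c' + c * a') ^ 2 := by
    have h1 : (2 * (b * b')) ^ 2 = 4 * (b ^ 2 * b' ^ 2) := by ring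
    have h2 : 4 * (a * c) * (a' * c') ≤ (a * c' + c * a') ^ 2 := by nlinarith [sq_nonneg (a * c' - c * a')]
    have h3 : b ^ 2 * b' ^ 2 ≤ (a * c) * (a' * c') :=
      mul_le_mul hS hT (sq_nonneg _) (mul_nonneg ha hc)
    nlinarith
  have habs : |2 * (b * b')| ≤ |a * c' + c * a'| := sq_le_sq.mp hsq
  rw [abs_of_nonneg hsum] at habs
  have := le_abs_self (2 * (b * b'))
  linarith

/-- **(L-x), strict form**: a positive-DEFINITE letter and a nonzero positive-semidefinite letter have POSITIVE polar form. [folklore] -/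
theorem ssr_polarDet_pos_of_pd_psd (a b c a' b' c' : ℝ) (ha : 0 < a) (hS : b ^ 2 < a * c)
    (ha' : 0 ≤ a') (hc' : 0 ≤ c') (hT : b' ^ 2 ≤ a' * c') (hT0 : a' ≠ 0 ∨ c' ≠ 0) :
    0 < a * c' + c * a' - 2 * (b * b') := by
  rcases eq_or_lt_of_le ha' with ha0 | ha'pos
  · -- a' = 0 ⇒ b' = 0 ⇒ polarDet = a c' with c' > 0
    have hb' : b' = 0 := by
      have : b' ^ 2 ≤ 0 := by rw [← ha0, zero_mul] at hT; exact hT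
      exact pow_eq_zero_iff (two_ne_zero) |>.mp (le_antisymm this (sq_nonneg _))
    have hc'pos : 0 < c' := by
      rcases hT0 with h | h
      · exact absurd ha0.symm h
      · exact lt_of_le_of_ne hc' (Ne.symm h)
    rw [← ha0, hb']
    nlinarith [mul_pos ha hc'pos]
  · -- a' > 0: `a a'·polarDet = (ac − b²)a'² + (a'b − ab')² + (a'c' − b'²)a²`
    have key : a * a' * (a * c' + c * a' - 2 * (b * b')) =
        (a * c - b ^ 2) * a' ^ 2 + (a' * b - a * b') ^ 2 + (a' * c' - b' ^ 2) * a ^ 2 := by ring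
    have h1 : 0 < (a * c - b ^ 2) * a' ^ 2 := mul_pos (by linarith) (by positivity)
    have h2 : 0 ≤ (a' * b - a * b') ^ 2 := sq_nonneg _
    have h3 : 0 ≤ (a' * c' - b' ^ 2) * a ^ 2 := mul_nonneg (by linarith) (sq_nonneg _)
    have hprod : 0 < a * a' * (a * c' + c * a' - 2 * (b * b')) := by rw [key]; linarith
    exact (mul_pos_iff_of_pos_left (mul_pos ha ha'pos)).mp hprod

end Summit.ValiantsHypothesis.ValiantsHypothesis.Theorems.LacunarySymmetroidMatrixDescartes.WallBubbling
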